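import Summits.AtomisticToContinuum.Crystallization.Theorems.PricedLinkCensusStackingHingeOfSupportCore
import Summits.AtomisticToContinuum.Crystallization.Theorems.PalmUnimodularRigidityBenjaminiSchrammLimitEnergy
import Summits.AtomisticToContinuum.Crystallization.Theorems.PricedLinkCensusStackingHingeAllPointsOfRoot
import Mathlib.Probability.Kernel.MeasurableIntegral

/-!
# `StackingHinge` (stmt-AtomisticToContinuum-14993), line `Sketch` (skeleton v37): stub `stub_rootPowerSums` (V1)

BOCHNER BOOKKEEPING UNDER THE HARD CORE.  For a probability law `P` on counting measures
`μ = count|S` of `ℝ³` that is a.s. rooted (`0 ∈ S`) and `δ`-separated, and a.s. bond-shell-good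
(twelve bonded neighbours of every point), the mean root energy splits into the two ROOT POWER
SUMS `S₆(P) = ∫∫ ‖y‖⁻⁶ dμ dP`, `S₁₂(P) = ∫∫ ‖y‖⁻¹² dμ dP`:
`E_P[½ ∫ V_LJ(‖y‖) dμ] = S₁₂/24 − S₆/12` and `S₁₂ > 0`
(`V_LJ(r) = r⁻¹²/12 − r⁻⁶/6`, `Literature.MathematicalPhysics.StatisticalMechanics.lennardJones`;
the root term vanishes on both sides by `0⁻¹ = 0`).

Proof.
* On a `δ`-separated `S ∋ 0`, `∑_{y ∈ T} ‖y‖⁻ⁿ ≤ 250 δ⁻ⁿ` for every finite `T ⊆ S` and `n ≥ 5`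
  (`sum_norm_inv_pow_le_of_separated`: off the root `‖y‖ ≥ δ`, so `‖y‖⁻ⁿ ≤ δ⁻⁽ⁿ⁻⁵⁾ ‖y‖⁻⁵`, and the
  landed shell sum `BenjaminiSchrammLimit.Finset.sum_norm_inv_pow_five_le`); hence `y ↦ ‖y‖⁻ⁿ` is
  `count|S`-integrable with integral `≤ 250 δ⁻ⁿ`
  (`integrable_norm_inv_pow_count_restrict`, through
  `BenjaminiSchrammLimit.lintegral_toMeasure_le_of_forall_finset`).
* So a.s. `∫ V_LJ = (1/12) ∫ ‖y‖⁻¹² − (1/6) ∫ ‖y‖⁻⁶` (linearity of the inner Bochner integral),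
  both inner integrals are bounded by `250 δ⁻ⁿ`, and `∫ ‖y‖⁻¹² dμ ≥ ‖y₁‖⁻¹² > 0` for one bonded
  neighbour `y₁ ≠ 0` of the root (`le_integral_count_restrict_of_mem`: `dirac y₁ ≤ count|S`).
* `μ ↦ ∫ g dμ` is strongly measurable for measurable `g` (`StronglyMeasurable.integral_kernel`
  for the identity kernel), so both `μ ↦ ∫ ‖y‖⁻ⁿ dμ` are `P`-integrable (bounded a.s., `P` finite);
  linearity of the outer Bochner integral gives the identity, and
  `integral_pos_iff_support_of_nonneg_ae` the positivity (the support has full measure).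

All `[folklore]`.
-/

noncomputable section

open MeasureTheory

namespace Summit.AtomisticToContinuum.Crystallization.Theorems.PricedHcpWindowsRootPowerSums

open Literature.MathematicalPhysics.StatisticalMechanics Literature.Probability.Process
open Summit.AtomisticToContinuum.Crystallization.Theorems.BenjaminiSchrammLimit
  (lintegral_toMeasure_le_of_forall_finset)
open Summit.AtomisticToContinuum.Crystallization.Theorems.PricedHcpWindowsAllPointsOfRoot
  (eq_of_count_restrict_eq)

variable {δ : ℝ} {S : Set (EuclideanSpace ℝ (Fin 3))}

/-! ## One configuration: shell sums of `‖y‖⁻ⁿ`, `n ≥ 5` -/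

/-- **Shell sum, any power `n ≥ 5`.**  On a `δ`-separated `S ∋ 0` (`δ > 0`), every finite
`T ⊆ S` has `∑_{y ∈ T} ‖y‖⁻ⁿ ≤ 250 δ⁻ⁿ`: the root contributes `0⁻ⁿ = 0`, every other point has
`‖y‖ ≥ δ`, so `‖y‖⁻ⁿ ≤ δ⁻⁽ⁿ⁻⁵⁾ ‖y‖⁻⁵`, and `∑ ‖y‖⁻⁵ ≤ 250 δ⁻⁵`
(`BenjaminiSchrammLimit.Finset.sum_norm_inv_pow_five_le`). [folklore] -/
theorem sum_norm_inv_pow_le_of_separated (hδ : 0 < δ)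
    (h0 : (0 : EuclideanSpace ℝ (Fin 3)) ∈ S)
    (hsep : ∀ x ∈ S, ∀ y ∈ S, x ≠ y → δ ≤ dist x y) {n : ℕ} (hn : 5 ≤ n)
    (T : Finset (EuclideanSpace ℝ (Fin 3))) (hT : (↑T : Set (EuclideanSpace ℝ (Fin 3))) ⊆ S) :
    ∑ y ∈ T, ‖y‖⁻¹ ^ n ≤ 250 * δ⁻¹ ^ n := by
  classical
  obtain ⟨m, rfl⟩ : ∃ m, n = m + 5 := ⟨n - 5, by omega⟩
  have h0sum : ∑ y ∈ T, ‖y‖⁻¹ ^ (m + 5) = ∑ y ∈ T.erase 0, ‖y‖⁻¹ ^ (m + 5) := by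
    by_cases h : (0 : EuclideanSpace ℝ (Fin 3)) ∈ T
    · rw [← Finset.add_sum_erase T _ h, norm_zero, inv_zero, zero_pow (by omega), zero_add]
    · rw [Finset.erase_eq_of_notMem h]
  rw [h0sum]
  have hT' : ∀ y ∈ T.erase 0, y ∈ S ∧ y ≠ 0 := fun y hy =>
    ⟨hT (Finset.mem_of_mem_erase hy), Finset.ne_of_mem_erase hy⟩
  have hnorm : ∀ y ∈ T.erase 0, δ ≤ ‖y‖ := fun y hy => by
    have := hsep y (hT' y hy).1 0 h0 (hT' y hy).2
    rwa [dist_zero_right] at this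
  calc ∑ y ∈ T.erase 0, ‖y‖⁻¹ ^ (m + 5)
      ≤ ∑ y ∈ T.erase 0, δ⁻¹ ^ m * ‖y‖⁻¹ ^ 5 := by
        refine Finset.sum_le_sum fun y hy => ?_
        rw [pow_add]
        exact mul_le_mul_of_nonneg_right
          (pow_le_pow_left₀ (inv_nonneg.2 (norm_nonneg _)) (inv_anti₀ hδ (hnorm y hy)) m)
          (by positivity)
    _ = δ⁻¹ ^ m * ∑ y ∈ T.erase 0, ‖y‖⁻¹ ^ 5 := by rw [Finset.mul_sum]
    _ ≤ δ⁻¹ ^ m * (250 * δ⁻¹ ^ 5) := by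
        refine mul_le_mul_of_nonneg_left
          (Summit.AtomisticToContinuum.Crystallization.Theorems.BenjaminiSchrammLimit.Finset.sum_norm_inv_pow_five_le
            _ hδ (fun y hy y' hy' hne => hsep y (hT' y hy).1 y' (hT' y' hy').1 hne) hnorm)
          (by positivity)
    _ = 250 * δ⁻¹ ^ (m + 5) := by ring

/-- **`y ↦ ‖y‖⁻ⁿ` is an honest sum on a hard-core configuration.**  On a `δ`-separated `S ∋ 0`
(`δ > 0`) and for `n ≥ 5`, `y ↦ ‖y‖⁻ⁿ` is `count|S`-integrable with `∫ ‖y‖⁻ⁿ d(count|S) ≤ 250 δ⁻ⁿ`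
(finite partial sums, `sum_norm_inv_pow_le_of_separated`, control the `lintegral` against the
counting measure of the countable `S`, `BenjaminiSchrammLimit.lintegral_toMeasure_le_of_forall_finset`).
[folklore] -/
theorem integrable_norm_inv_pow_count_restrict (hδ : 0 < δ)
    (h0 : (0 : EuclideanSpace ℝ (Fin 3)) ∈ S)
    (hsep : ∀ x ∈ S, ∀ y ∈ S, x ≠ y → δ ≤ dist x y) {n : ℕ} (hn : 5 ≤ n) :
    Integrable (fun y : EuclideanSpace ℝ (Fin 3) => ‖y‖⁻¹ ^ n)
        ((Measure.count : Measure (EuclideanSpace ℝ (Fin 3))).restrict S) ∧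
      ∫ y, ‖y‖⁻¹ ^ n ∂((Measure.count : Measure (EuclideanSpace ℝ (Fin 3))).restrict S) ≤
        250 * δ⁻¹ ^ n := by
  set μ := (Measure.count : Measure (EuclideanSpace ℝ (Fin 3))).restrict S
  have hmeas : Measurable fun y : EuclideanSpace ℝ (Fin 3) => ‖y‖⁻¹ ^ n :=
    (measurable_norm.inv).pow_const n
  have hnn : 0 ≤ᵐ[μ] fun y : EuclideanSpace ℝ (Fin 3) => ‖y‖⁻¹ ^ n :=
    ae_of_all _ fun y => by positivity
  have hlin : ∫⁻ y, ENNReal.ofReal (‖y‖⁻¹ ^ n) ∂μ ≤ ENNReal.ofReal (250 * δ⁻¹ ^ n) :=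
    lintegral_toMeasure_le_of_forall_finset hδ
      (⟨LocalConfig.mk S, h0, hsep⟩ :
        LocalConfig.RootedHardCoreConfig (EuclideanSpace ℝ (Fin 3)) δ)
      (g := fun y => ENNReal.ofReal (‖y‖⁻¹ ^ n)) (c := ENNReal.ofReal (250 * δ⁻¹ ^ n))
      fun T hT => by
        rw [← ENNReal.ofReal_sum_of_nonneg fun y _ => by positivity]
        exact ENNReal.ofReal_le_ofReal (sum_norm_inv_pow_le_of_separated hδ h0 hsep hn T hT)
  have hint : Integrable (fun y : EuclideanSpace ℝ (Fin 3) => ‖y‖⁻¹ ^ n) μ :=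
    ⟨hmeas.aestronglyMeasurable,
      (hasFiniteIntegral_iff_ofReal hnn).2 (hlin.trans_lt ENNReal.ofReal_lt_top)⟩
  refine ⟨hint, ?_⟩
  have h := ofReal_integral_eq_lintegral_ofReal hint hnn
  have h' : ENNReal.ofReal (∫ y, ‖y‖⁻¹ ^ n ∂μ) ≤ ENNReal.ofReal (250 * δ⁻¹ ^ n) := h ▸ hlin
  exact (ENNReal.ofReal_le_ofReal_iff (by positivity)).1 h'

/-- **One atom bounds the sum from below.**  For `f ≥ 0` integrable against `count|S` and
`y ∈ S`, `f y ≤ ∫ f d(count|S)` (`dirac y ≤ count|S` and `integral_mono_measure`). [folklore] -/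
theorem le_integral_count_restrict_of_mem {f : EuclideanSpace ℝ (Fin 3) → ℝ} (hf : ∀ z, 0 ≤ f z)
    (hint : Integrable f ((Measure.count : Measure (EuclideanSpace ℝ (Fin 3))).restrict S))
    {y : EuclideanSpace ℝ (Fin 3)} (hy : y ∈ S) :
    f y ≤ ∫ z, f z ∂((Measure.count : Measure (EuclideanSpace ℝ (Fin 3))).restrict S) := by
  have hle : Measure.dirac y ≤ (Measure.count : Measure (EuclideanSpace ℝ (Fin 3))).restrict S := by
    refine Measure.le_iff.2 fun s hs => ?_
    rw [Measure.dirac_apply' _ hs, Measure.restrict_apply hs]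
    by_cases hys : y ∈ s
    · rw [Set.indicator_of_mem hys, Pi.one_apply,
        ← Measure.count_singleton (α := EuclideanSpace ℝ (Fin 3)) y]
      exact measure_mono (Set.singleton_subset_iff.2 ⟨hys, hy⟩)
    · rw [Set.indicator_of_notMem hys]
      exact bot_le
  calc f y = ∫ z, f z ∂(Measure.dirac y) := (integral_dirac f y).symm
    _ ≤ ∫ z, f z ∂((Measure.count : Measure (EuclideanSpace ℝ (Fin 3))).restrict S) :=
        integral_mono_measure hle (ae_of_all _ hf) hint

/-! ## The registered stub -/

/-- **V1 `stub_rootPowerSums`** (Bochner bookkeeping under the hard core).  For a probability law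
`P` on counting measures of `ℝ³`, a.s. rooted and `δ`-separated and a.s. everywhere
bond-shell-good (twelve bonded neighbours), the mean root energy splits into the two ROOT POWER
SUMS, `E_P[½∫V_LJ(‖y‖)dμ] = S₁₂(P)/24 − S₆(P)/12` with `S_k(P) = ∫∫ ‖y‖⁻ᵏ dμ dP` (the root
term is `0` by `0⁻¹ = 0`), and `S₁₂(P) > 0`.  Proof: a.s. both inner integrals are honest sums
bounded by `250 δ⁻ᵏ` (`integrable_norm_inv_pow_count_restrict`) and the inner integral is linear;
`μ ↦ ∫ ‖y‖⁻ᵏ dμ` is measurable (`StronglyMeasurable.integral_kernel`, identity kernel), hence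
`P`-integrable, and the outer integral is linear; positivity from one bonded neighbour of the
root (`le_integral_count_restrict_of_mem`) and `integral_pos_iff_support_of_nonneg_ae`.
[folklore] -/
theorem stub_rootPowerSums : ∀ δ : ℝ, 0 < δ → ∀ P : MeasureTheory.Measure (MeasureTheory.Measure (EuclideanSpace ℝ (Fin 3))), MeasureTheory.IsProbabilityMeasure P → (∀ᵐ μ ∂P, (∃ S : Set (EuclideanSpace ℝ (Fin 3)), (0 : EuclideanSpace ℝ (Fin 3)) ∈ S ∧ (∀ x ∈ S, ∀ y ∈ S, x ≠ y → δ ≤ dist x y) ∧ μ = (MeasureTheory.Measure.count : MeasureTheory.Measure (EuclideanSpace ℝ (Fin 3))).restrict S)) → (∀ᵐ μ ∂P, ∃ S : Set (EuclideanSpace ℝ (Fin 3)), μ = (MeasureTheory.Measure.count : MeasureTheory.Measure (EuclideanSpace ℝ (Fin 3))).restrict S ∧ ∀ x ∈ S, (∀ t r : ℝ, Metric.infDist x (S \ {x}) / 6 < t → r < 3 * Metric.infDist x (S \ {x}) → ∃ s : ℤ → ℤ, Literature.MathematicalPhysics.StatisticalMechanics.IsHaggSeq s ∧ ∃ g : EuclideanSpace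 ℝ (Fin 3) ≃ᵃⁱ[ℝ] EuclideanSpace ℝ (Fin 3), (∀ y ∈ S, dist x y ≤ r → ∃ z ∈ Literature.MathematicalPhysics.StatisticalMechanics.barlowStacking (Metric.infDist x (S \ {x})) (Metric.infDist x (S \ {x}) * Real.sqrt (2 / 3)) s, dist y (g z) ≤ t) ∧ (∀ z ∈ Literature.MathematicalPhysics.StatisticalMechanics.barlowStacking (Metric.infDist x (S \ {x})) (Metric.infDist x (S \ {x}) * Real.sqrt (2 / 3)) s, dist x (g z) ≤ r → ∃ y ∈ S, dist y (g z) ≤ t)) ∧ ((∀ y ∈ S, y ≠ x → dist x y < 107 / 100 * Metric.infDist x (S \ {x}) → dist x y ≤ 101 / 100 * Metric.infDist x (S \ {x})) ∧ ∃ T : Finset (EuclideanSpace ℝ (Fin 3)), (↑T : Set (EuclideanSpace ℝ (Fin 3))) ⊆ {y : EuclideanSpace ℝ (Fin 3) | y ∈ S ∧ y ≠ x ∧ dist x y ≤ 101 / 100 * Metric.infDist x (S \ {x})} ∧ T.card = 12)) → (∫ μ, (∫ y, Literature.MathematicalPhysics.StatisticalMechanics.lennardJones ‖y‖ ∂μ)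 / 2 ∂P) = (∫ μ, (∫ y, (‖y‖⁻¹) ^ 12 ∂μ) ∂P) / 24 - (∫ μ, (∫ y, (‖y‖⁻¹) ^ 6 ∂μ) ∂P) / 12 ∧ 0 < (∫ μ, (∫ y, (‖y‖⁻¹) ^ 12 ∂μ) ∂P) := by
  intro δ hδ P hP hcore hgood
  -- a.s. bookkeeping on one configuration
  have hae : ∀ᵐ μ ∂P,
      (∫ y, lennardJones ‖y‖ ∂μ) / 2 =
          (∫ y, ‖y‖⁻¹ ^ 12 ∂μ) / 24 - (∫ y, ‖y‖⁻¹ ^ 6 ∂μ) / 12 ∧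
        ∫ y, ‖y‖⁻¹ ^ 12 ∂μ ≤ 250 * δ⁻¹ ^ 12 ∧ ∫ y, ‖y‖⁻¹ ^ 6 ∂μ ≤ 250 * δ⁻¹ ^ 6 ∧
        0 < ∫ y, ‖y‖⁻¹ ^ 12 ∂μ := by
    filter_upwards [hcore, hgood] with μ hμ hμ'
    obtain ⟨S, h0, hsep, rfl⟩ := hμ
    obtain ⟨S', hS', hgoodS'⟩ := hμ'
    obtain rfl : S = S' := eq_of_count_restrict_eq hS'
    obtain ⟨hint12, hle12⟩ :=
      integrable_norm_inv_pow_count_restrict hδ h0 hsep (show 5 ≤ 12 by norm_num)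
    obtain ⟨hint6, hle6⟩ :=
      integrable_norm_inv_pow_count_restrict hδ h0 hsep (show 5 ≤ 6 by norm_num)
    refine ⟨?_, hle12, hle6, ?_⟩
    · have hV : (fun y : EuclideanSpace ℝ (Fin 3) => lennardJones ‖y‖) =
          fun y => (1 / 12) * ‖y‖⁻¹ ^ 12 - (1 / 6) * ‖y‖⁻¹ ^ 6 := rfl
      rw [hV, integral_sub (hint12.const_mul _) (hint6.const_mul _), integral_const_mul,
        integral_const_mul]
      ring
    · obtain ⟨-, T, hT, hcard⟩ := (hgoodS' 0 h0).2
      obtain ⟨y, hy⟩ : T.Nonempty := Finset.card_pos.1 (by rw [hcard]; norm_num)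
      obtain ⟨hyS, hy0, -⟩ := hT (Finset.mem_coe.2 hy)
      have hypos : 0 < ‖y‖⁻¹ ^ 12 := pow_pos (inv_pos.2 (norm_pos_iff.2 hy0)) 12
      exact hypos.trans_le (le_integral_count_restrict_of_mem
        (f := fun z : EuclideanSpace ℝ (Fin 3) => ‖z‖⁻¹ ^ 12) (fun _ => by positivity) hint12 hyS)
  -- measurability and `P`-integrability of the two root power sums
  -- (`μ ↦ ∫ g dμ` is `StronglyMeasurable.integral_kernel` for the identity kernel `μ ↦ μ`, as in the
  -- landed `PalmGoodLaw.ZeroMeanStress.stronglyMeasurable_integral_measure`, whose module is not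
  -- importable next to this line's skeleton)
  have hSM : ∀ n : ℕ, AEStronglyMeasurable
      (fun μ : Measure (EuclideanSpace ℝ (Fin 3)) => ∫ y, ‖y‖⁻¹ ^ n ∂μ) P := fun n =>
    (((measurable_norm.inv).pow_const n).stronglyMeasurable.integral_kernel
      (κ := (⟨fun μ => μ, measurable_id⟩ :
        ProbabilityTheory.Kernel (Measure (EuclideanSpace ℝ (Fin 3)))
          (EuclideanSpace ℝ (Fin 3))))).aestronglyMeasurable
  have hI : ∀ n : ℕ, (∀ᵐ μ ∂P, ∫ y, ‖y‖⁻¹ ^ n ∂μ ≤ 250 * δ⁻¹ ^ n) →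
      Integrable (fun μ : Measure (EuclideanSpace ℝ (Fin 3)) => ∫ y, ‖y‖⁻¹ ^ n ∂μ) P :=
    fun n hn => Integrable.of_bound (hSM n) (250 * δ⁻¹ ^ n) (hn.mono fun μ hμ => by
      rw [Real.norm_of_nonneg (integral_nonneg fun _ => by positivity)]
      exact hμ)
  have hI12 := hI 12 (hae.mono fun μ h => h.2.1)
  have hI6 := hI 6 (hae.mono fun μ h => h.2.2.1)
  refine ⟨?_, ?_⟩
  · calc ∫ μ, (∫ y, lennardJones ‖y‖ ∂μ) / 2 ∂P
        = ∫ μ, ((∫ y, ‖y‖⁻¹ ^ 12 ∂μ) / 24 - (∫ y, ‖y‖⁻¹ ^ 6 ∂μ) / 12) ∂P :=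
          integral_congr_ae (hae.mono fun μ h => h.1)
      _ = (∫ μ, ∫ y, ‖y‖⁻¹ ^ 12 ∂μ ∂P) / 24 - (∫ μ, ∫ y, ‖y‖⁻¹ ^ 6 ∂μ ∂P) / 12 := by
          rw [integral_sub (hI12.div_const 24) (hI6.div_const 12), integral_div, integral_div]
  · have hnn : 0 ≤ᵐ[P] fun μ : Measure (EuclideanSpace ℝ (Fin 3)) => ∫ y, ‖y‖⁻¹ ^ 12 ∂μ :=
      ae_of_all _ fun μ => integral_nonneg fun _ => by positivity
    rw [integral_pos_iff_support_of_nonneg_ae hnn hI12, pos_iff_ne_zero]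
    intro hzero
    obtain ⟨μ, hμ1, hμ2⟩ := ((measure_eq_zero_iff_ae_notMem.1 hzero).and hae).exists
    exact hμ1 (Function.mem_support.2 hμ2.2.2.2.ne')

end Summit.AtomisticToContinuum.Crystallization.Theorems.PricedHcpWindowsRootPowerSums

end
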